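import Literature.NumberTheory.Automorphic.QuadraticHeckeCharacter
import Literature.NumberTheory.Automorphic.QuaternionRamificationParityHolds
import HarnessLib

/-!
# The local components of the quadratic Hecke character `ω_{F(√θ)/F}` are the Hilbert symbols `( · , θ)_v`

Topic `NumberTheory/Automorphic`; namespace `Literature.NumberTheory.Automorphic`. Everything here is proved.

`QuadraticHeckeCharacter.lean` constructs, for a number field `F` and a non-square `θ ∈ 𝓞 F`, the quadratic
Hecke character `ω = quadraticHeckeChar F θ` of `E = F(√θ)` as the sign character of the index-two subgroup
`P_F · N_{E/F} J_E = principalIdeles F ⊔ normIdeles F θ` of `𝕀_F` (O'Meara 65:21), and computes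
`ω(ϖ_v)` at the places `v ∤ 2θ`. This file computes the **local component `ω_v = ω ∘ ⟨·⟩_v` at EVERY
finite place** `v` (`⟨c⟩_v = localUnits v c`, the idèle with component `c` at `v` and `1` elsewhere):

* `localUnits_mem_principalIdeles_sup_normIdeles_iff` — **`⟨c⟩_v ∈ P_F · N_{E/F} J_E ↔ c ∈ N(F_v(√θ)ˣ)`**
  (`quadraticNormSubgroup F_v θ`). "←": a local norm padded with `1`'s is a norm idèle
  (`localUnits_mem_normIdeles_iff`). "→": if `⟨c⟩_v = (γ)·n` with `n` a norm idèle, then `γ` is a local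
  norm at every place `≠ v` (there `⟨c⟩_v` has component `1`), so the places with `(γ, θ)_𝔭 = -1` are `∅` or
  `{v}`; by **Hilbert's reciprocity law** (O'Meara 71:18, the tree's theorem `hilbertReciprocity_holds`:
  their number is even) they are `∅`, so `γ` is a local norm at `v` too and `c = γ · n_v` is one. This is
  O'Meara's argument in the proof of 71:19 ("`φ(𝔦) = ∏_{𝔭 ∈ Ω} (𝔦_𝔭, β / 𝔭)` is trivial on `P_F`", p. 203) read
  on the generator `⟨c⟩_v`; the tree had it for the RANGE of `localUnits v` at a place where `θ` is not a
  local square (`not_range_localUnits_le_of_not_isSquare`, `SolvableBaseChangeModularityProofs.lean`).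
* `quadraticHeckeChar_localUnits` / `localComponent_quadraticHeckeChar` — **`ω(⟨c⟩_v) = (c, θ)_v`**, the
  local Hilbert symbol, at every finite place `v` and every `c ∈ F_vˣ`: the local component of the global
  quadratic character is the local quadratic character `c ↦ (c, θ)_v` of `F_v(√θ)/F_v` (local–global
  compatibility of class field theory in the quadratic case; O'Meara §65A "`α` is a local norm at `𝔭` iff
  `(α, θ)_𝔭 = 1`" + the above).
* `quadraticHeckeChar_localUnits_eq_one_iff` — `ω(⟨c⟩_v) = 1 ↔ (c, θ)_v = 1 ↔ c` is a local norm.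

Provenance: this is the tree-vocabulary form of the `pub-hodgecm` package theorems
`NumberField.finIdeleSingle_mem_quadraticNormGroup_iff` / `coe_quadraticCharacter_finIdeleSingle`
(`HodgeCM/Literature/QuadraticCharacterLocal.lean`, gen 6, gate run 27), re-proved over the tree's
`quadraticHeckeChar` (same subgroup `principalIdeles ⊔ normIdeles`). Not here: the infinite places (the
tree's `localUnits` is the finite-place embedding; at a real place `w` with `w(θ) < 0` the component is the
sign character, at the other infinite places it is trivial), and O'Meara's product formula
`ω(𝔦) = ∏_𝔭 (𝔦_𝔭, θ)_𝔭` for a general idèle.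

## References

* O. T. O'Meara, *Introduction to Quadratic Forms*, Grundlehren 117 (1963), §65A (Example 65:2, local norms and
  the Hilbert symbol), §65D Prop. 65:21, §71D Thm. 71:18 and proof of Thm. 71:19. [Omeara1963]
* J. Tate, *Global class field theory*, in Cassels–Fröhlich (1967), Ch. VII §6 (local components of the norm
  residue character). [CasselsFrohlichANT1967]
-/

noncomputable section

open scoped NumberField
open NumberField IsDedekindDomain

namespace Literature.NumberTheory.Automorphic

open QuadraticForms GaloisRepresentations

variable (K : Type) [Field K] [NumberField K]

/-- **`⟨c⟩_v ∈ P_K · N_{K(√θ)/K} J ↔ c` is a local norm at `v`** (O'Meara 71:18 ⇒ the local condition at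
one place is implied by the others): for `θ ≠ 0`, a finite place `v` and `c ∈ K_vˣ`, the `v`-idèle `⟨c⟩_v`
lies in `principalIdeles K ⊔ normIdeles K θ` iff `c ∈ quadraticNormSubgroup K_v θ`.
[cite: Omeara1963, §71D Thm. 71:18 and proof of Thm. 71:19] -/
theorem localUnits_mem_principalIdeles_sup_normIdeles_iff {θ : K} (hθ0 : θ ≠ 0)
    (v : HeightOneSpectrum (𝓞 K)) (c : (v.adicCompletion K)ˣ) :
    localUnits v c ∈ principalIdeles K ⊔ normIdeles K θ ↔
      c ∈ quadraticNormSubgroup (v.adicCompletion K) (algebraMap K _ θ) := by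
  classical
  refine ⟨fun hmem ↦ ?_, fun hc ↦ Subgroup.mem_sup_right ((localUnits_mem_normIdeles_iff θ v c).2 hc)⟩
  by_contra hcN
  haveI : CharZero (v.adicCompletion K) :=
    charZero_of_injective_algebraMap (algebraMap K _).injective
  -- read `γ` off `⟨c⟩_v = (γ) · n`: the places where `(γ, θ)_𝔭 = -1` are exactly `{v}`
  obtain ⟨γ, hγ⟩ := exists_placeSymbol_eq_neg_one_iff_of_mem_sup hθ0 hmem
  have hbad : badPlaces (γ : K) θ = {Sum.inl v} := by
    ext p
    rw [mem_badPlaces_iff, hγ, Set.mem_singleton_iff]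
    cases p with
    | inl v' =>
      rw [isLocalNormAt_inl]
      by_cases hv' : v' = v
      · subst hv'
        rw [ideleFiniteComponent_localUnits_self]
        exact ⟨fun _ ↦ rfl, fun _ ↦ hcN⟩
      · rw [ideleFiniteComponent_localUnits_of_ne K _ hv']
        simp only [one_mem, not_true_eq_false, Sum.inl.injEq, hv']
    | inr w =>
      rw [isLocalNormAt_inr, ideleInfiniteComponent_localUnits]
      simp only [one_mem, not_true_eq_false, reduceCtorEq]
  -- one exceptional place: odd, against Hilbert reciprocity
  have hcard := ncard_badPlaces (K := K) γ.ne_zero hθ0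
  rw [hbad, Set.ncard_singleton] at hcard
  have heven := (hilbertReciprocity_holds K (γ : K) θ γ.ne_zero hθ0).2
  rw [← hcard] at heven
  exact Nat.not_even_one heven

variable {K}

/-- **`ω(⟨c⟩_v) = 1 ↔ c` is a local norm at `v`** for the quadratic Hecke character `ω = quadraticHeckeChar K θ`
and every finite place `v`. [cite: Omeara1963, §65A and §71D proof of Thm. 71:19] -/
theorem quadraticHeckeChar_localUnits_eq_one_iff_mem {θ : 𝓞 K} (hθ : ¬ IsSquare (θ : K))
    (v : HeightOneSpectrum (𝓞 K)) (c : (v.adicCompletion K)ˣ) :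
    quadraticHeckeChar K θ hθ (localUnits v c) = 1 ↔
      c ∈ quadraticNormSubgroup (v.adicCompletion K) (algebraMap K _ (θ : K)) := by
  have hθ0 : (θ : K) ≠ 0 := by exact_mod_cast RingOfIntegers.ne_zero_of_not_isSquare K hθ
  rw [← localUnits_mem_principalIdeles_sup_normIdeles_iff K hθ0 v c]
  constructor
  · intro h
    by_contra hn
    have h' := quadraticHeckeChar_apply_of_not_mem hθ hn
    rw [h] at h'
    exact absurd (Units.ext_iff.1 h') (by norm_num)
  · exact quadraticHeckeChar_apply_of_mem hθ

/-- **`ω(⟨c⟩_v) = 1 ↔ (c, θ)_v = 1`.** [cite: Omeara1963, §65A] -/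
theorem quadraticHeckeChar_localUnits_eq_one_iff {θ : 𝓞 K} (hθ : ¬ IsSquare (θ : K))
    (v : HeightOneSpectrum (𝓞 K)) (c : (v.adicCompletion K)ˣ) :
    quadraticHeckeChar K θ hθ (localUnits v c) = 1 ↔
      hilbertSymbol (v.adicCompletion K) (c : v.adicCompletion K) (algebraMap K _ (θ : K)) = 1 := by
  haveI : CharZero (v.adicCompletion K) :=
    charZero_of_injective_algebraMap (algebraMap K _).injective
  have hθ0 : (θ : K) ≠ 0 := by exact_mod_cast RingOfIntegers.ne_zero_of_not_isSquare K hθ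
  have hθv : algebraMap K (v.adicCompletion K) (θ : K) ≠ 0 := (_root_.map_ne_zero _).2 hθ0
  rw [quadraticHeckeChar_localUnits_eq_one_iff_mem hθ v c,
    hilbertSymbol_eq_one_iff_mem_quadraticNormSubgroup hθv c]

/-- **The local components of the quadratic Hecke character are the Hilbert symbols**: for the quadratic
Hecke character `ω = quadraticHeckeChar K θ` of `K(√θ)/K`, every finite place `v` and every `c ∈ K_vˣ`,
`ω(⟨c⟩_v) = (c, θ)_v` (O'Meara's "`φ(𝔦) = ∏_𝔭 (𝔦_𝔭, θ)_𝔭`" on the generators `⟨c⟩_v`; the local component of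
the global norm-residue character of `K(√θ)/K` is the local one of `K_v(√θ)/K_v`).
[cite: Omeara1963, §71D proof of Thm. 71:19] -/
theorem quadraticHeckeChar_localUnits {θ : 𝓞 K} (hθ : ¬ IsSquare (θ : K))
    (v : HeightOneSpectrum (𝓞 K)) (c : (v.adicCompletion K)ˣ) :
    ((quadraticHeckeChar K θ hθ (localUnits v c) : ℂˣ) : ℂ) =
      (hilbertSymbol (v.adicCompletion K) (c : v.adicCompletion K) (algebraMap K _ (θ : K)) : ℂ) := by
  haveI : CharZero (v.adicCompletion K) :=
    charZero_of_injective_algebraMap (algebraMap K _).injective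
  have hθ0 : (θ : K) ≠ 0 := by exact_mod_cast RingOfIntegers.ne_zero_of_not_isSquare K hθ
  have hθv : algebraMap K (v.adicCompletion K) (θ : K) ≠ 0 := (_root_.map_ne_zero _).2 hθ0
  by_cases hc : c ∈ quadraticNormSubgroup (v.adicCompletion K) (algebraMap K _ (θ : K))
  · rw [(quadraticHeckeChar_localUnits_eq_one_iff_mem hθ v c).2 hc,
      (hilbertSymbol_eq_one_iff_mem_quadraticNormSubgroup hθv c).2 hc, Units.val_one, Int.cast_one]
  · have hmem : localUnits v c ∉ principalIdeles K ⊔ normIdeles K (θ : K) :=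
      fun h ↦ hc ((localUnits_mem_principalIdeles_sup_normIdeles_iff K hθ0 v c).1 h)
    rw [quadraticHeckeChar_apply_of_not_mem hθ hmem,
      (hilbertSymbol_eq_neg_one_iff_not_mem_quadraticNormSubgroup hθv c).2 hc, Units.val_neg, Units.val_one,
      Int.cast_neg, Int.cast_one]

/-- The same for the bundled local component `ω_v = ω.localComponent v : K_vˣ →* ℂˣ`.
[cite: Omeara1963, §71D proof of Thm. 71:19] -/
theorem localComponent_quadraticHeckeChar {θ : 𝓞 K} (hθ : ¬ IsSquare (θ : K))
    (v : HeightOneSpectrum (𝓞 K)) (c : (v.adicCompletion K)ˣ) :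
    (((quadraticHeckeChar K θ hθ).localComponent v c : ℂˣ) : ℂ) =
      (hilbertSymbol (v.adicCompletion K) (c : v.adicCompletion K) (algebraMap K _ (θ : K)) : ℂ) := by
  rw [HeckeCharacter.localComponent_apply, quadraticHeckeChar_localUnits]

end Literature.NumberTheory.Automorphic

end
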